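import Summits.CriticalPhenomena.PercolationContinuityZ3.Theorems.Transplant.FKRayleighK4
import HarnessLib

/-!
# Connectivity correlation inequalities for `φ_{w,q}`, every `q > 0` — negative correlation of ADJACENT edges (statements, conjecture node,
# and the proved instances)

Support file (`--supports stmt-CriticalPhenomena-4575`), FK sub-lane `prim-bschramm-fk-3` (gen 6) of the post-continuity
programme; builds on p205010 (kernel theorem, internal audit signed; external expert review pending).  No named facts, no sorries;
standard axioms.

FINDING OF THIS SEAT (exact computations, bschramm/FK-BARRIER.md §10.3): the negative-correlation bracket of the master identity
(`FK.negCorr_defect_eq`) for two edges `e = xy`, `f = xz` SHARING A VERTEX is COEFFICIENTWISE nonnegative — in the odds variables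
`y_g = p_g/(1 − p_g)` of the remaining pairs, with each monomial's coefficient written in the Bernstein basis of `q ∈ [0,1]` — on every
connected graph with `≤ 5` vertices (560 adjacent pairs, kit j108737), every connected graph with `6` vertices and `≤ 9` edges (2,764 pairs,
kit j108738), and on `K₅`, `K₃,₃`, the prism and the wheel `W₄`; moreover in every tested case the negative terms inject into the positive
terms monomial by monomial with non-increasing `q`-exponent.  For DISJOINT pairs this fails (100 of 262 pairs at `n ≤ 5`; `K₄` needs the
square of `…FKRayleighK4Cert.lean`).  This is the random-cluster (`0 < q ≤ 1`) analogue of Wagner's Conjectures 5.3/5.4, which are stated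
for the forest generating polynomial only.  Hence the conjecture node below — negative correlation of ADJACENT edges for every `q < 1` —
recorded `@[conjecture]` (NOT asserted; for `q ≥ 1` edges are POSITIVELY correlated by FKG, so this is a `q < 1` statement).  Proved here: it follows from full edge-negative association (`EdgeNegCorrOn`), hence holds on every
weighted graph with `≤ 4` vertices (`edgeNegCorrOn_of_card_le_four`) and — through `Wagner2008_rc_edgeNegCorr_of_noK4Minor_holds` — on
every `K₄`-minor-free support.
[cite: Wagner2006, Ex. 5.2, Conj. 5.3, Conj. 5.4 (p. 13)] [cite: Grimmett2006, §3.9 eq. (3.94), Conj. (3.96) (pp. 63–65)]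
-/

noncomputable section

namespace Summit.CriticalPhenomena.PercolationContinuityZ3.Theorems

namespace FK

open MeasureTheory Set Literature.Probability.LatticeModels Literature.Probability.Percolation
open scoped Classical

/-- **Negative correlation of ADJACENT edges under `φ_{w,q}` on the finite vertex type `V`**: `φ(J_e ∩ J_f) ≤ φ(J_e)·φ(J_f)` for every
weight vector, all non-loop pairs `e ≠ f` that share a vertex. [cite: Grimmett2006, §3.9 eq. (3.94) (p. 63)]
[cite: Wagner2006, Conj. 5.3 (p. 13)] -/
def EdgeNegCorrAdjOn (V : Type*) [Fintype V] (q : ℝ) : Prop :=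
  ∀ (w : Sym2 V → unitInterval) (e f : Sym2 V), ¬ e.IsDiag → ¬ f.IsDiag → f ≠ e → (∃ v : V, v ∈ e ∧ v ∈ f) →
    (rcMeasureW w q ∅).real ({ω | e ∈ ω} ∩ {ω | f ∈ ω}) ≤
      (rcMeasureW w q ∅).real {ω | e ∈ ω} * (rcMeasureW w q ∅).real {ω | f ∈ ω}

/-- **Negative correlation of adjacent edges for `φ_{w,q}` on every finite weighted graph** (vertex types `Fin n`).
[cite: Grimmett2006, §3.9 eq. (3.94) (p. 63)] -/
def EdgeNegCorrAdjFK (q : ℝ) : Prop := ∀ n : ℕ, EdgeNegCorrAdjOn (Fin n) q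

/-- **Negative correlation of adjacent edges for every `0 < q < 1`.**  CONJECTURE-SHAPED STATEMENT, NOT asserted.  It is the slice of
Grimmett's open problem (edge-negative association for `q < 1`, §3.9) for pairs of edges with a common vertex; the random-cluster analogue of
Wagner's Conjecture 5.3 (stated for the forest polynomial).  Evidence (this lane, fk-3 gen 6, 2026-08-20; bschramm/FK-BARRIER.md §10.3): the
master-identity bracket is coefficientwise nonnegative (odds variables ⊗ `q`-Bernstein) for all 560 adjacent pairs of the connected graphs on
`≤ 5` vertices (kit j108737) and all 2,764 adjacent pairs of the connected 6-vertex graphs with `≤ 9` edges (kit j108738), and for `K₅`, `K₃,₃`,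
prism, `W₄`, with an exponent-respecting injection of negative into positive terms in every tested monomial; disjoint pairs fail coefficientwise.
Equivalent reading (master identity; `ν = φ` on `G − e − f`, `r = q⁻¹ − 1`): `(1 + r)·ν(y ↔ z, x ↮ z) ≥ r·Cov_ν(1{x ↔ y}, 1{x ↔ z})`, a bound
on the hub covariance at `x`.  Proved cases: `≤ 4` vertices and `K₄`-minor-free supports (below). [cite: Wagner2006, Conj. 5.3, Conj. 5.4 (p. 13)]
[cite: Grimmett2006, §3.9 (pp. 63–65)] -/
@[conjecture] def EdgeNegCorrAdjFKLtOne : Prop := ∀ q : ℝ, 0 < q → q < 1 → EdgeNegCorrAdjFK q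

/-- Full edge-negative association gives the adjacent slice. [folklore] -/
theorem edgeNegCorrAdjOn_of_edgeNegCorrOn {V : Type*} [Fintype V] {q : ℝ} (h : EdgeNegCorrOn V q) : EdgeNegCorrAdjOn V q :=
  fun w e f he _ hfe _ => h w e f he hfe

/-- `EdgeNegCorrFKLtOne → EdgeNegCorrAdjFKLtOne`. [folklore] -/
theorem edgeNegCorrAdjFKLtOne_of_edgeNegCorrFKLtOne (h : EdgeNegCorrFKLtOne) : EdgeNegCorrAdjFKLtOne :=
  fun q hq0 hq1 n => edgeNegCorrAdjOn_of_edgeNegCorrOn (h q hq0 hq1 n)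

/-- **Adjacent edges are negatively correlated on every weighted graph with at most four vertices, `0 < q ≤ 1`** (kernel:
`edgeNegCorrOn_of_card_le_four`, i.e. the discharged Wagner theorem for `≤ 3` vertices and '`K₄` is Potts–Rayleigh').
[cite: Wagner2006, Ex. 5.2, §5.3] -/
theorem edgeNegCorrAdjOn_of_card_le_four {V : Type*} [Fintype V] (hV : Fintype.card V ≤ 4) {q : ℝ} (hq0 : 0 < q) (hq1 : q ≤ 1) :
    EdgeNegCorrAdjOn V q :=
  edgeNegCorrAdjOn_of_edgeNegCorrOn (edgeNegCorrOn_of_card_le_four hV hq0 hq1)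

/-- **Adjacent edges are negatively correlated on every `K₄`-minor-free weighted graph, `0 < q ≤ 1`** (the discharged Wagner theorem).
[cite: Wagner2006, Thm. 5.8(d), §5.3] -/
theorem edgeNegCorrAdj_of_noK4Minor {n : ℕ} (w : Sym2 (Fin n) → unitInterval) {q : ℝ} (hq0 : 0 < q) (hq1 : q ≤ 1)
    (hK : ¬ HasK4Minor (SimpleGraph.fromEdgeSet {e : Sym2 (Fin n) | ((w e : unitInterval) : ℝ) ≠ 0})) (e f : Sym2 (Fin n))
    (he : ¬ e.IsDiag) (hfe : f ≠ e) :
    (rcMeasureW w q ∅).real ({ω | e ∈ ω} ∩ {ω | f ∈ ω}) ≤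
      (rcMeasureW w q ∅).real {ω | e ∈ ω} * (rcMeasureW w q ∅).real {ω | f ∈ ω} :=
  Wagner2008_rc_edgeNegCorr_of_noK4Minor_holds n w q hq0 hq1 hK e f he hfe

end FK

end Summit.CriticalPhenomena.PercolationContinuityZ3.Theorems

end
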